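import Summits.HubbardSuperconductivity.HubbardSuperconductivity.Theorems.AnisotropyChordTransferFlipPinning
import Summits.HubbardSuperconductivity.HubbardSuperconductivity.Theorems.AnisotropyChordTransferEven
import Summits.HubbardSuperconductivity.HubbardSuperconductivity.Theorems.AnisotropyChordTowerXYAnchor
import Literature.MathematicalPhysics.QuantumLattice.SectorGroundProjContinuity
import Literature.MathematicalPhysics.QuantumLattice.HardCoreBosonHalfFillingOptimal

/-!
# Route `AnisotropyChord` / H0 rotor rung, route (1): **THEOREM Z⁺ — hypothesis (H3) of THEOREM T DISCHARGED**
# (the `Sᶻ = 0` sector of the easy-plane XXZ ferromagnet carries the ground energy; even torus, `|Δ| < 1`)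

Theory seat `hubbard-h0-rotor-theory-1`, THEOREM-Z.md / memo ROTOR-THEORY-11 §176 (THEOREM Z⁺); on bipartite graphs the statement is
Mattis, PRL 42 (1979) 1503 / Nishimori, J. Stat. Phys. 26 (1981) 839 (restated in Tasaki, arXiv:1807.05847 §3.2); the even torus
`(ℤ/L)²` is bipartite.  Prover seat `hubbard-h0-rotor-p1` g14.

PROOF (Lean, this file + `…TransferParityFlips/FlipEntries/FlipPinning`).  Let `E₀` be the global minimum of the Rayleigh quotient
of `H(Δ) = xxzHamiltonian 1 (torusGraph 2 L) (−1) Δ`, attained at `v₀` (`exists_unit_eigen_minEnergyOn`).  Rotate by the tree's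
frame change `U` (`exists_frame_xyzBondHamiltonian₃`): `U H(Δ) Uᴴ = H'(1,Δ,1)` is stoquastic and parity preserving with non-zero
double-flip entries for `|Δ| < 1`, `U Sᶻ_tot Uᴴ = −Sʸ_tot`, and `[H(Δ), Sᶻ_tot] = 0` (tree `commute_xxzHamiltonian_totalSpin_two`)
transports to `[H', Sʸ_tot] = 0`.  The pinning lemma (`exists_eigenvector_ker_of_flipParity`, with `⨂σʸ`) gives an eigenvector of
`H'` at `E₀` killed by `Sʸ_tot`; rotating back, a ground vector `u` of `H(Δ)` with `Sᶻ_tot u = 0` (`exists_groundVector_sectorZero`).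
The variational principle in the sector `0` and on the whole space give `E(0) ≤ E₀ ≤ E(M)` (`sectorE_zero_le_of_even`).

CONSEQUENCES: `sectorZeroGlobalGroundEven_holds : |Δ| < 1 → SectorZeroGlobalGroundEven Δ` ((H3)-even of THEOREM T), and THEOREM T
with (H3) discharged: `firstLinksUpTo_of_symmetricGap`, `condensateOnFirstSectors_of_symmetricGap` — for `0 ≤ Δ < 1`, KLS anchor
(H1) + the symmetric `z = 1` sector gap (H2) ⇒ BEC of hard-core bosons on `(ℤ/L)²` in every sector `N = L²/2 + j`, `j ≤ k`; at the
XY point `Δ = 0`, where (H1) is the tree's `halfFillingAnchor_xy` (Kennedy–Lieb–Shastry), conditional on (H2) ONLY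
(`condensateOnFirstSectors_xy_of_symmetricGap`).  Nothing here is a statement about the Hubbard model.
-/

set_option linter.dupNamespace false
set_option autoImplicit false

noncomputable section

open Finset Matrix
open scoped ComplexOrder
open Literature.MathematicalPhysics.QuantumLattice

namespace Summit.HubbardSuperconductivity.HubbardSuperconductivity.Theorems.AnisotropyChord.Transfer

/-! ## THEOREM Z⁺ on the even torus: the `Sᶻ = 0` sector carries the ground energy -/

section Torus

open Complex Literature.MathematicalPhysics.QuantumLattice.SpinOperators Literature.Probability.LatticeModels
open Summit.HubbardSuperconductivity.HubbardSuperconductivity.Theorems.AnisotropyChord.InsertionEntropy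
open Summit.AtomisticToContinuum.BoseEinsteinCondensation.Theorems.BECStronglyRayleighSectorPerron (torusGraph_connected)

/-! ### unitary conjugation bookkeeping -/

section Unitary

variable {ι : Type*} [Fintype ι] [DecidableEq ι]

/-- `(U A Uᴴ)(U v) = U (A v)`. [folklore] -/
theorem conj_mulVec_mulVec {U : Matrix ι ι ℂ} (hU' : Uᴴ * U = 1) (A : Matrix ι ι ℂ) (v : ι → ℂ) :
    (U * A * Uᴴ) *ᵥ (U *ᵥ v) = U *ᵥ (A *ᵥ v) := by
  rw [Matrix.mulVec_mulVec, Matrix.mulVec_mulVec, Matrix.mul_assoc, Matrix.mul_assoc, hU', Matrix.mul_one]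

omit [DecidableEq ι] in
/-- `⟨v, (U A Uᴴ) v⟩ = ⟨Uᴴv, A Uᴴv⟩`. [folklore] -/
theorem star_dotProduct_conj_mulVec (U A : Matrix ι ι ℂ) (v : ι → ℂ) :
    star v ⬝ᵥ (U * A * Uᴴ) *ᵥ v = star (Uᴴ *ᵥ v) ⬝ᵥ A *ᵥ (Uᴴ *ᵥ v) := by
  rw [Matrix.star_mulVec, Matrix.conjTranspose_conjTranspose, ← Matrix.dotProduct_mulVec, Matrix.mulVec_mulVec,
    Matrix.mulVec_mulVec, Matrix.mul_assoc]

/-- `⟨Uᴴv, Uᴴv⟩ = ⟨v, v⟩` for `U Uᴴ = 1`. [folklore] -/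
theorem star_dotProduct_conjTranspose_mulVec {U : Matrix ι ι ℂ} (hU : U * Uᴴ = 1) (v : ι → ℂ) :
    star (Uᴴ *ᵥ v) ⬝ᵥ (Uᴴ *ᵥ v) = star v ⬝ᵥ v := by
  rw [Matrix.star_mulVec, Matrix.conjTranspose_conjTranspose, ← Matrix.dotProduct_mulVec, Matrix.mulVec_mulVec, hU,
    Matrix.one_mulVec]

/-- `(U A Uᴴ)(U B Uᴴ) = U (A B) Uᴴ` for `Uᴴ U = 1`. [folklore] -/
theorem conj_mul_conj {U : Matrix ι ι ℂ} (hU' : Uᴴ * U = 1) (A B : Matrix ι ι ℂ) :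
    U * A * Uᴴ * (U * B * Uᴴ) = U * (A * B) * Uᴴ := by
  simp only [Matrix.mul_assoc]
  rw [← Matrix.mul_assoc Uᴴ U (B * Uᴴ), hU', Matrix.one_mul]

/-- a matrix with a left inverse is injective on vectors. [folklore] -/
theorem mulVec_ne_zero_of_left_inverse {U V : Matrix ι ι ℂ} (hVU : V * U = 1) {v : ι → ℂ} (hv : v ≠ 0) :
    U *ᵥ v ≠ 0 := by
  intro h
  apply hv
  have := congrArg (fun w => V *ᵥ w) h
  simp only [Matrix.mulVec_mulVec, hVU, Matrix.one_mulVec, Matrix.mulVec_zero] at this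
  exact this

end Unitary

variable (L : ℕ) [NeZero L]

/-- **`H(Δ) = H'(1, 1, Δ)`**: the route's XXZ torus Hamiltonian is Björnberg–Ueltschi's three-coupling bond Hamiltonian with
couplings `(1, 1, Δ)` (same statement as the tree's `LevyLogBootstrap.xxzTorus_eq_xyzBondHamiltonian₃`, reproved to keep the import
graph route-local). [folklore] -/
theorem ham_eq_xyzBondHamiltonian₃ (Δ : ℝ) :
    xxzHamiltonian 1 (torusGraph 2 L) (-1) Δ = xyzBondHamiltonian₃ (d := 2) L 1 1 1 Δ := by
  rw [xxzHamiltonian, xyzBondHamiltonian₃, Complex.ofReal_neg, Complex.ofReal_one, neg_one_smul]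
  congr 1
  refine Finset.sum_congr rfl fun e _ => ?_
  induction e using Sym2.ind with
  | h x y => simp only [Sym2.lift_mk, xyzBond₃, Complex.ofReal_one, one_smul]

/-- `|(ℤ/L)²| = 2·(2k²)` for `L = 2k`. [folklore] -/
theorem card_torusSite_two_of_even {k : ℕ} (hk : L = k + k) : Fintype.card (TorusSite 2 L) = 2 * (2 * k ^ 2) := by
  rw [Fintype.card_fun, ZMod.card, Fintype.card_fin, hk]; ring

/-- **THEOREM Z⁺ in the rotated frame (even torus, `|Δ| < 1`)**: the stoquastic `H'(1, Δ, 1) = −Σ(SˣSˣ + ΔSʸSʸ + SᶻSᶻ)`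
has, at every energy `E` that bounds its quadratic form from below and is attained by an eigenvector, an eigenvector annihilated
by `Sʸ_tot` (`exists_eigenvector_ker_of_flipParity` with the torus entries of `H'`, `Sʸ_tot` and `⨂σʸ`). [folklore] -/
theorem exists_eigenvector_ker_totalSpinY_torus (hL : Even L) {Δ : ℝ} (hΔ : |Δ| < 1) {E : ℝ}
    (hE : ∀ v : TensorIndex (TorusSite 2 L) 2 → ℂ,
      E * (star v ⬝ᵥ v).re ≤ (star v ⬝ᵥ xyzBondHamiltonian₃ (d := 2) L 1 1 Δ 1 *ᵥ v).re)
    {v₀ : TensorIndex (TorusSite 2 L) 2 → ℂ} (hv₀ : v₀ ≠ 0)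
    (hHv₀ : xyzBondHamiltonian₃ (d := 2) L 1 1 Δ 1 *ᵥ v₀ = (E : ℂ) • v₀) :
    ∃ w : TensorIndex (TorusSite 2 L) 2 → ℂ, w ≠ 0 ∧
      xyzBondHamiltonian₃ (d := 2) L 1 1 Δ 1 *ᵥ w = (E : ℂ) • w ∧ (totalSpin 1 1 : Op (TorusSite 2 L) 2) *ᵥ w = 0 := by
  obtain ⟨k, hk⟩ := hL
  have hm := card_torusSite_two_of_even L hk
  have hΔ1 : -Δ ≤ 1 := by have := (abs_lt.1 hΔ).1; linarith
  have hΔ2 : Δ ≤ 1 := (abs_lt.1 hΔ).2.le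
  obtain ⟨hreal, hsymm, hoff⟩ := xyzBondHamiltonian₃_entries (d := 2) L 1 1 Δ 1 hΔ1 hΔ2
  set Ht := xyzBondHamiltonian₃ (d := 2) L 1 1 Δ 1 with hHt
  set Y : Op (TorusSite 2 L) 2 := totalSpin 1 1 with hY
  set Gt : Op (TorusSite 2 L) 2 := productOp (fun _ : TorusSite 2 L => spinHalfPauli 1) with hGt
  -- commutation of `Gt` with `Ht` and `Y` from the conjugation identities
  obtain ⟨hGG, hGG'⟩ := flipOp_mul_conjTranspose (Λ := TorusSite 2 L)
  have hHG : Ht * Gt = Gt * Ht := by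
    have h := flipOp_conj_xyzBondHamiltonian₃ (d := 2) L 1 Δ 1
    calc Ht * Gt = Gt * Ht * Gtᴴ * Gt := by rw [h]
      _ = Gt * Ht := by rw [Matrix.mul_assoc, hGG', Matrix.mul_one]
  have hYG : Y * Gt = Gt * Y := by
    have h := flipOp_conj_totalSpin_one (Λ := TorusSite 2 L)
    calc Y * Gt = Gt * Y * Gtᴴ * Gt := by rw [h]
      _ = Gt * Y := by rw [Matrix.mul_assoc, hGG', Matrix.mul_one]
  -- commutation of `Ht` with `Y`: transport of `[H(Δ), Sᶻ_tot] = 0` through the frame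
  obtain ⟨U, hU, hU', hUH, hUx, hUy, hUz⟩ := exists_frame_xyzBondHamiltonian₃ (d := 2) L 1 1 1 Δ
  have hSz : U * (totalSpin 1 2 : Op (TorusSite 2 L) 2) * Uᴴ = -Y := by
    rw [hY, totalSpin, totalSpin, Finset.mul_sum, Finset.sum_mul, ← Finset.sum_neg_distrib]
    exact Finset.sum_congr rfl fun x _ => hUz x
  have hcomm := (HardCoreBoson.commute_xxzHamiltonian_totalSpin_two 1 (torusGraph 2 L) (-1) Δ).eq
  rw [ham_eq_xyzBondHamiltonian₃] at hcomm
  have hHY : Ht * Y = Y * Ht := by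
    have h1 : Ht = U * xyzBondHamiltonian₃ (d := 2) L 1 1 1 Δ * Uᴴ := hUH.symm
    have h2 : Y = -(U * (totalSpin 1 2 : Op (TorusSite 2 L) 2) * Uᴴ) := by rw [hSz, neg_neg]
    rw [h1, h2, mul_neg, neg_mul, conj_mul_conj hU' _ _, conj_mul_conj hU' _ _, hcomm]
  -- the double-flip entries are non-zero for `|Δ| < 1`
  have hflip : ∀ (x y : TorusSite 2 L) (σ : TensorIndex (TorusSite 2 L) 2), (torusGraph 2 L).Adj x y →
      Ht σ (flipAt x (flipAt y σ)) ≠ 0 := by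
    intro x y σ hxy
    rw [hHt, xyzBondHamiltonian₃_one_apply_doubleFlip (d := 2) L 1 Δ 1 hxy σ, neg_ne_zero, Complex.ofReal_ne_zero]
    have h1 := (abs_lt.1 hΔ).1
    have h2 := (abs_lt.1 hΔ).2
    split_ifs <;> · intro h; linarith
  exact exists_eigenvector_ker_of_flipParity (torusGraph 2 L) (torusGraph_connected 2 L) hm Ht Y Gt hreal hsymm hoff
    (fun σ τ h => xyzBondHamiltonian₃_one_apply_of_parity_ne (d := 2) L 1 Δ 1 h) hflip hHY hHG hYG
    (fun σ τ h => totalSpin_one_one_apply_of_parity_eq h) (flipOp_mulVec_of_even hm) hE hv₀ hHv₀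

/-- **THEOREM Z⁺ on the even torus (Mattis 1979 / Nishimori 1981 on bipartite graphs; theory seat THEOREM-Z.md, memo ROTOR-THEORY-11
§176): for `|Δ| < 1` the XXZ ferromagnet `H(Δ) = −Σ_{xy}[SˣSˣ + SʸSʸ + Δ SᶻSᶻ]` on `(ℤ/L)²`, `L` even, has a GROUND VECTOR IN THE
SECTOR `Sᶻ_tot = 0`.**  Proof: the global minimum `E₀` of the Rayleigh quotient is attained (`exists_unit_eigen_minEnergyOn`); rotate
by the tree's frame change `U` (`Sˣ ↦ −Sᶻ ↦ Sʸ ↦ Sˣ`, `H(Δ) ↦ H'(1,Δ,1)`, `Sᶻ_tot ↦ −Sʸ_tot`); in that frame the pinning lemma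
gives an eigenvector at `E₀` killed by `Sʸ_tot`; rotate back. [folklore] -/
theorem exists_groundVector_sectorZero (hL : Even L) {Δ : ℝ} (hΔ : |Δ| < 1) :
    ∃ u : TensorIndex (TorusSite 2 L) 2 → ℂ, u ≠ 0 ∧
      (∀ v : TensorIndex (TorusSite 2 L) 2 → ℂ,
        (xxzHamiltonian 1 (torusGraph 2 L) (-1) Δ).minEnergyOn ⊤ * (star v ⬝ᵥ v).re ≤
          (star v ⬝ᵥ xxzHamiltonian 1 (torusGraph 2 L) (-1) Δ *ᵥ v).re) ∧
      xxzHamiltonian 1 (torusGraph 2 L) (-1) Δ *ᵥ u =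
        (((xxzHamiltonian 1 (torusGraph 2 L) (-1) Δ).minEnergyOn ⊤ : ℝ) : ℂ) • u ∧
      (totalSpin 1 2 : Op (TorusSite 2 L) 2) *ᵥ u = 0 := by
  set H : Op (TorusSite 2 L) 2 := xxzHamiltonian 1 (torusGraph 2 L) (-1) Δ with hHdef
  have hH : H.IsHermitian := xxzHamiltonian_isHermitian 1 (torusGraph 2 L) (-1) Δ
  set E₀ : ℝ := H.minEnergyOn ⊤ with hE₀
  -- the global ground vector and the global lower bound
  have htop : (⊤ : Submodule ℂ (TensorIndex (TorusSite 2 L) 2 → ℂ)) ≠ ⊥ := by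
    intro h
    have hmem : (fun _ => (1 : ℂ)) ∈ (⊤ : Submodule ℂ (TensorIndex (TorusSite 2 L) 2 → ℂ)) := Submodule.mem_top
    rw [h, Submodule.mem_bot] at hmem
    exact one_ne_zero (congrFun hmem (fun _ => 0))
  obtain ⟨v₀, -, hv₀1, hHv₀⟩ := exists_unit_eigen_minEnergyOn hH ⊤ (fun v _ => Submodule.mem_top) htop
  have hv₀ : v₀ ≠ 0 := by
    intro h; rw [h, dotProduct_zero] at hv₀1; exact zero_ne_one hv₀1
  have hE : ∀ v : TensorIndex (TorusSite 2 L) 2 → ℂ, E₀ * (star v ⬝ᵥ v).re ≤ (star v ⬝ᵥ H *ᵥ v).re :=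
    fun v => minEnergyOn_mul_le_re_rayleigh hH ⊤ Submodule.mem_top
  -- the frame
  obtain ⟨U, hU, hU', hUH, hUx, hUy, hUz⟩ := exists_frame_xyzBondHamiltonian₃ (d := 2) L 1 1 1 Δ
  set Ht := xyzBondHamiltonian₃ (d := 2) L 1 1 Δ 1 with hHt
  have hHt' : Ht = U * H * Uᴴ := by rw [hHdef, ham_eq_xyzBondHamiltonian₃]; exact hUH.symm
  have hSz : U * (totalSpin 1 2 : Op (TorusSite 2 L) 2) * Uᴴ = -(totalSpin 1 1 : Op (TorusSite 2 L) 2) := by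
    rw [totalSpin, totalSpin, Finset.mul_sum, Finset.sum_mul, ← Finset.sum_neg_distrib]
    exact Finset.sum_congr rfl fun x _ => hUz x
  -- the rotated ground vector and lower bound
  have hEt : ∀ v : TensorIndex (TorusSite 2 L) 2 → ℂ, E₀ * (star v ⬝ᵥ v).re ≤ (star v ⬝ᵥ Ht *ᵥ v).re := by
    intro v
    rw [hHt', star_dotProduct_conj_mulVec, ← star_dotProduct_conjTranspose_mulVec hU v]
    exact hE _
  have hv₀t : U *ᵥ v₀ ≠ 0 := mulVec_ne_zero_of_left_inverse hU' hv₀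
  have hHv₀t : Ht *ᵥ (U *ᵥ v₀) = (E₀ : ℂ) • (U *ᵥ v₀) := by
    rw [hHt', conj_mulVec_mulVec hU', hHv₀, Matrix.mulVec_smul]
  obtain ⟨w, hw0, hHw, hYw⟩ := exists_eigenvector_ker_totalSpinY_torus L hL hΔ hEt hv₀t hHv₀t
  -- rotate back
  refine ⟨Uᴴ *ᵥ w, ?_, hE, ?_, ?_⟩
  · have hU'' : (Uᴴ)ᴴ * Uᴴ = 1 := by rw [Matrix.conjTranspose_conjTranspose]; exact hU
    exact mulVec_ne_zero_of_left_inverse (U := Uᴴ) (V := U) hU hw0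
  · have hHU : H = Uᴴ * Ht * U := by
      rw [hHt']
      calc H = (Uᴴ * U) * H * (Uᴴ * U) := by rw [hU', Matrix.one_mul, Matrix.mul_one]
        _ = Uᴴ * (U * H * Uᴴ) * U := by simp only [Matrix.mul_assoc]
    rw [hHU, Matrix.mulVec_mulVec, Matrix.mul_assoc, Matrix.mul_assoc, hU, Matrix.mul_one, ← Matrix.mulVec_mulVec, hHw,
      Matrix.mulVec_smul]
  · have hSzU : (totalSpin 1 2 : Op (TorusSite 2 L) 2) = -(Uᴴ * (totalSpin 1 1 : Op (TorusSite 2 L) 2) * U) := by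
      calc (totalSpin 1 2 : Op (TorusSite 2 L) 2) = (Uᴴ * U) * totalSpin 1 2 * (Uᴴ * U) := by
            rw [hU', Matrix.one_mul, Matrix.mul_one]
        _ = Uᴴ * (U * totalSpin 1 2 * Uᴴ) * U := by simp only [Matrix.mul_assoc]
        _ = -(Uᴴ * totalSpin 1 1 * U) := by rw [hSz, Matrix.mul_neg, Matrix.neg_mul, Matrix.mul_assoc]
    rw [hSzU, Matrix.neg_mulVec, Matrix.mulVec_mulVec, Matrix.mul_assoc, Matrix.mul_assoc, hU, Matrix.mul_one,
      ← Matrix.mulVec_mulVec, hYw, Matrix.mulVec_zero, neg_zero]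

/-- **(H3)-even HOLDS for the Perron data of the route: on an even torus, for `|Δ| < 1`, `E(0) ≤ E(M)` for every sector `M`
carrying a Perron sector ground amplitude** (THEOREM Z⁺: the ground vector in `Sᶻ_tot = 0` gives `E(0) ≤ E_ground ≤ E(M)` by the
variational principle in the sector `0` and on the whole space). [folklore] -/
theorem sectorE_zero_le_of_even (hL : Even L) {Δ : ℝ} (hΔ : |Δ| < 1) (M : ℝ)
    (a : TensorIndex (TorusSite 2 L) 2 → ℝ) (ha : IsPerronSectorGroundAmplitude L Δ M a) :
    sectorE L Δ 0 ≤ sectorE L Δ M := by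
  obtain ⟨u, hu0, hE, hHu, hSzu⟩ := exists_groundVector_sectorZero L hL hΔ
  set H : Op (TorusSite 2 L) 2 := xxzHamiltonian 1 (torusGraph 2 L) (-1) Δ with hHdef
  have hH : H.IsHermitian := xxzHamiltonian_isHermitian 1 (torusGraph 2 L) (-1) Δ
  set E₀ : ℝ := H.minEnergyOn ⊤ with hE₀
  -- `u ∈ 𝓗_0`
  have humem : u ∈ spinZSector (Λ := TorusSite 2 L) 1 (0 : ℝ) := by
    rw [spinZSector, Module.End.mem_eigenspace_iff, Matrix.toLin'_apply, hSzu, Complex.ofReal_zero, zero_smul]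
  have hupos : 0 < (star u ⬝ᵥ u).re := EigenvalueContinuation.re_star_dotProduct_self_pos hu0
  -- `E(0) ≤ E₀`
  have h0 : sectorE L Δ 0 ≤ E₀ := by
    have h := minEnergyOn_mul_le_re_rayleigh hH (spinZSector (Λ := TorusSite 2 L) 1 (0 : ℝ)) humem
    rw [hHu, dotProduct_smul, smul_eq_mul, Complex.re_ofReal_mul] at h
    exact le_of_mul_le_mul_right h hupos
  -- `E₀ ≤ E(M)`
  have h1 : E₀ ≤ sectorE L Δ M := by
    have h := hE (fun σ => (a σ : ℂ))
    rw [ha.eigen, dotProduct_smul, smul_eq_mul, Complex.re_ofReal_mul, PerronFrobenius.re_star_dotProduct_self_real] at h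
    have hunit : ∑ σ, a σ * a σ = 1 := by rw [← ha.unit]; exact Finset.sum_congr rfl fun σ _ => (sq (a σ)).symm
    rw [hunit, mul_one, mul_one] at h
    exact h
  exact h0.trans h1

end Torus

/-! ## (H3) discharged; THEOREM T conditional on (H2) only -/

section Consequences

open Filter Topology Literature.Probability.LatticeModels
open Summit.HubbardSuperconductivity.HubbardSuperconductivity.Theorems.AnisotropyChord.InsertionEntropy
open Summit.HubbardSuperconductivity.HubbardSuperconductivity.Theorems.AnisotropyChord.Tower

/-- **(H3)-even HOLDS (THEOREM Z⁺, torus corollary): for every `|Δ| < 1`, on every even torus the `Sᶻ = 0` sector carries the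
global ground energy, `E(0) ≤ E(M)` for every sector with a Perron amplitude** — the guarded hypothesis (H3) of THEOREM T
(`SectorZeroGlobalGroundEven`, theory seat PartE.lean) is a theorem.  Mattis 1979 / Nishimori 1981 (bipartite graphs); theory seat
THEOREM-Z.md. [folklore] -/
theorem sectorZeroGlobalGroundEven_holds {Δ : ℝ} (hΔ : |Δ| < 1) : SectorZeroGlobalGroundEven Δ :=
  fun L _ hL M a ha => sectorE_zero_le_of_even L hL hΔ M a ha

/-- **THEOREM T with (H3), (H4), LEMMA E, TRANSFER discharged: XY-LM₀(ε) on the first `k` links from (H1) + (H2).**  For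
`0 ≤ Δ < 1`: KLS anchor `HalfFillingAnchor Δ c₀` + symmetric `z = 1` sector gap `SymmetricSectorGap Δ c₁ (k+1)` ⇒ for every
`ε > 0`, eventually in `L`, `⟨S⃗²⟩_{ψ_j} ≥ ⟨S⃗²⟩_{ψ_0} − ε|V|²` for `j ≤ k`.
[conjecture: theory seat hubbard-h0-rotor-theory-1, cycle 12, memo §175 — THEOREM T, now conditional on (H2) only; Lean proof here] -/
theorem firstLinksUpTo_of_symmetricGap {Δ c₀ c₁ : ℝ} {k : ℕ} (hΔ0 : 0 ≤ Δ) (hΔ1 : Δ < 1) (hc₀ : 0 < c₀) (hc₁ : 0 < c₁)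
    (hA : HalfFillingAnchor Δ c₀) (hGap : SymmetricSectorGap Δ c₁ (k + 1)) (ε : ℝ) (hε : 0 < ε) :
    FirstLinksUpTo Δ ε k :=
  transferTheoremEven_holds Δ c₀ c₁ k hΔ0 hΔ1 hc₀ hc₁ hA hGap
    (sectorZeroGlobalGroundEven_holds (abs_lt.2 ⟨by linarith, hΔ1⟩)) (perronTranslationInvariant_holds Δ)
    ladderExcessBound_holds spinSquaredTransfer_holds ε hε

/-- **THEOREM T in the H0 chain's currency, conditional on (H2) ONLY: for `0 ≤ Δ < 1`, KLS anchor (H1) + symmetric `z = 1` sector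
gap (H2) ⇒ `CondensateOnFirstSectors Δ k`** — BEC of hard-core bosons on `(ℤ/L)²` in each sector `N = L²/2 + j`, `j ≤ k`,
eventually in `L` ((H3) = THEOREM Z⁺, (H4), LEMMA E and TRANSFER are theorems of the tree).
[conjecture: theory seat hubbard-h0-rotor-theory-1, cycle 12 — CONDITIONAL RUNG T, conditional on (H2) only; Lean proof here] -/
theorem condensateOnFirstSectors_of_symmetricGap {Δ c₀ c₁ : ℝ} {k : ℕ} (hΔ0 : 0 ≤ Δ) (hΔ1 : Δ < 1)
    (hc₀ : 0 < c₀) (hc₁ : 0 < c₁) (hA : HalfFillingAnchor Δ c₀) (hGap : SymmetricSectorGap Δ c₁ (k + 1)) :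
    CondensateOnFirstSectors Δ k :=
  condensateOnFirstSectors_of_gap_even hΔ0 hΔ1 hc₀ hc₁ hA hGap
    (sectorZeroGlobalGroundEven_holds (abs_lt.2 ⟨by linarith, hΔ1⟩))

/-- **At the XY point (hard-core bosons on `(ℤ/L)²`): BEC in EVERY fixed sector `N = L²/2 + j`, `j ≤ k`, conditional ONLY on the
symmetric `z = 1` sector gap (H2)** — the anchor (H1) at `Δ = 0` is the tree's `halfFillingAnchor_xy` (Kennedy–Lieb–Shastry 1988).
[conjecture: theory seat hubbard-h0-rotor-theory-1, cycle 12 — CONDITIONAL RUNG T at the XY point, conditional on (H2) only; Lean proof here] -/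
theorem condensateOnFirstSectors_xy_of_symmetricGap {c₁ : ℝ} {k : ℕ} (hc₁ : 0 < c₁) (hGap : SymmetricSectorGap 0 c₁ (k + 1)) :
    CondensateOnFirstSectors 0 k := by
  obtain ⟨c₀, hc₀, hA⟩ := halfFillingAnchor_xy
  exact condensateOnFirstSectors_of_symmetricGap le_rfl one_pos hc₀ hc₁ hA hGap

end Consequences

end Summit.HubbardSuperconductivity.HubbardSuperconductivity.Theorems.AnisotropyChord.Transfer
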